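import Summits.BirchSwinnertonDyer.Rank1Residual.X11b.KrausMinimalityTwoUnit
import Literature.NumberTheory.EllipticCurves.MordellCurveTateAlgorithmTwoProofs
import HarnessLib

/-!
# BSD rank-≤1 residual cell: Kraus's criterion at `2` in GENERAL form (no bound on `ord₂ Δ` or
# `ord₂ c₄`) and a support-based (unbounded) global-minimality criterion for integer models

HONEST FRAMING (cell `b2b-bsdres-*`, verbatim): prove what is provable now; shrink each hard class
to its core with data; no claim beyond stated classes; COMBINATION classes deleted from PUBLISHED
theorems only, CONSTRUCTION-shaped remainder typed; this is not "finishing BSD". Unit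
`b2b-bsdres-x11c` (gen 9). Theorems only (no definition, no named fact); a TOOL file.

The bounded Kraus/Silverman criteria of `Rank1ResidualX11RankOneMinimality.lean` /
`KrausMinimalityTwoUnit.lean` decide global minimality of Cremona's model for every in-window
certificate record, through Silverman's disjuncts `q¹² ∤ Δ ∨ q⁴ ∤ c₄` and FOUR special necessity
instances of Kraus 1989 Prop. 2 at `2` (F2a, F2b, F2c, the `2⁶·L` unit pattern), each under a bound
`ord₂ Δ < 24` or `ord₂ c₄ < 8` that pins a would-be descent to `u = 2w`, and under `|Δ| < 512¹²`.
Beyond the window (`2·10⁴ ≤ N < 5·10⁵`, the X11b ∧ p ≥ 5 certificate campaign) 140 models need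
other residues of `c₆/2⁶` and 56 have `|Δ| ≥ 512¹²`. This file removes both restrictions:

* `isMinimal_two_of_kraus_fails_general` — a `2`-adically integral equation `Y` is
  minimal as soon as, for NO `2`-adic unit `w`, the pair `(c₄/(16w⁴), c₆/(64w⁶))` satisfies Kraus's
  necessary condition (`kraus_two_of_integral`: `(|c₄'| ≤ 2⁻⁴ ∧ (|c₆'| ≤ 2⁻⁵ ∨ |c₆' − 8| ≤ 2⁻⁵)) ∨
  |c₆' + 1| ≤ 2⁻²`) — WITHOUT the hypothesis `|Δ| > 2⁻²⁴` of `isMinimal_of_kraus_fails_of_Δ`: an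
  integral descent `C • Y` with `ord₂ u = k ≥ 1` is RESCALED by `2^{k-1}` (which keeps integrality,
  `a_i ↦ 2^{(k-1)i} a_i`) to an integral equation with invariants `(c₄/(16w⁴), c₆/(64w⁶))`,
  `w = u/2ᵏ` a unit, to which Kraus's necessity applies.
* `isMinimalAt_two_of_kraus_violated` — integer form for `W = [a₁,…,a₆]`: if `c₄ = 16x`, `c₆ = 64y`
  with `¬((16 ∣ x ∧ (32 ∣ y ∨ 32 ∣ y − 8)) ∨ 4 ∣ y + 1)`, then `W` is minimal at `2` (the unit `w`
  only moves `c₆'` by `y(w⁻⁶ − 1) ∈ 8yℤ₂`, which changes none of the three tests).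
* `isGloballyMinimal_of_krausCriterion_support` — global minimality of an integer model from a list
  `bad` of primes carrying the support of `Δ` (`|Δ| = ∏ q^{e_q}`), with, at each listed `q`,
  Silverman's disjuncts, or (`q = 2`) the integer Kraus test above, or (`q = 3`) `3⁸ ‖ c₆`; primes
  off the list do not divide `Δ`. No size bound on `Δ`: the shape `decide` evaluates per record.

References: A. Kraus, Acta Arith. 54 (1989) Prop. 1, Prop. 2 [Kraus1989]; J. E. Cremona,
*Algorithms for Modular Elliptic Curves* (1997) §3.2 (Laska–Kraus–Connell) [CremonaAlgorithms1997];
J. H. Silverman, *AEC* (2009) VII.1 Remark 1.1, III.1 Table 3.1 [SilvermanAEC2009].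
-/

set_option autoImplicit false

noncomputable section

open scoped Classical

open IsDedekindDomain NumberField Rat.HeightOneSpectrum WeierstrassCurve
  Literature.NumberTheory.EllipticCurves
  Literature.NumberTheory.EllipticCurves.Rank1Residual.X11RankOneCertificates
  Literature.NumberTheory.GaloisRepresentations Literature.NumberTheory.DiophantineGeometry
  Summit.BirchSwinnertonDyer.BirchSwinnertonDyer.Rank1Residual.X11RankOne

namespace Summit.BirchSwinnertonDyer.Rank1Residual.X11b

section Two

variable (v : HeightOneSpectrum (𝓞 ℚ))

/-- **Minimality at `2` from the failure of Kraus's conditions — general form (no bound on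
`ord₂ Δ`).** Let `Y` be a `2`-adically integral Weierstrass equation over `ℚ₂`. If
for no `2`-adic unit `w` the pair `(c₄(Y)/(16w⁴), c₆(Y)/(64w⁶))` satisfies Kraus's necessary
condition (`kraus_two_of_integral`), then `Y` is minimal. Proof: an integral `C • Y` with
`|u⁻¹| = 2ᵏ`, `k ≥ 1`, rescaled by the change `(2^{1-k}, 0, 0, 0)` is still integral
(`a_i ↦ 2^{(k-1)i}a_i`) and has `c₄ = c₄(Y)/(16w⁴)`, `c₆ = c₆(Y)/(64w⁶)` with `w = u/2ᵏ` a unit.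
[cite: Kraus1989, Prop. 2] [cite: SilvermanAEC2009, VII.1 (minimal equations) and III.1 Table 3.1] -/
theorem isMinimal_two_of_kraus_fails_general (hv : natGenerator v = 2)
    (Y : WeierstrassCurve (v.adicCompletion ℚ)) [Y.IsIntegral (v.adicCompletionIntegers ℚ)]
    (hK : ∀ w : v.adicCompletion ℚ, Valued.v w = 1 →
      ¬ ((Valued.v (Y.c₄ / (16 * w ^ 4)) ≤ WithZero.exp (-4 : ℤ) ∧
          (Valued.v (Y.c₆ / (64 * w ^ 6)) ≤ WithZero.exp (-5 : ℤ) ∨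
            Valued.v (Y.c₆ / (64 * w ^ 6) - 8) ≤ WithZero.exp (-5 : ℤ))) ∨
        Valued.v (Y.c₆ / (64 * w ^ 6) + 1) ≤ WithZero.exp (-2 : ℤ))) :
    Y.IsMinimal (v.adicCompletionIntegers ℚ) := by
  have V2 := valued_two v hv
  have h20 : (2 : v.adicCompletion ℚ) ≠ 0 := by
    intro h; rw [h, Valuation.map_zero] at V2; exact WithZero.coe_ne_zero V2.symm
  have hV1 : ∀ x : v.adicCompletion ℚ,
      x ∈ (algebraMap (v.adicCompletionIntegers ℚ) (v.adicCompletion ℚ)).range → Valued.v x ≤ 1 :=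
    fun x hx ↦ (valued_le_one_iff_mem_range_adicCompletionIntegers v x).mpr hx
  rw [isMinimal_iff_of_le_one_iff (valued_le_one_iff_mem_range_adicCompletionIntegers v)]
  refine ⟨inferInstance, fun C hC ↦ ?_⟩
  haveI := hC
  rw [variableChange_Δ, Valuation.map_mul, Valuation.map_pow]
  set U : WithZero (Multiplicative ℤ) := Valued.v (↑C.u⁻¹ : v.adicCompletion ℚ) with hU
  by_cases hU1 : U ≤ 1
  · exact mul_le_of_le_one_left zero_le (pow_le_one₀ zero_le hU1)
  exfalso
  replace hU1 : 1 < U := not_le.mp hU1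
  have hU0 : U ≠ 0 := (Valuation.ne_zero_iff _).mpr (Units.ne_zero _)
  -- `U = exp k`, `k ≥ 1`, `k = m + 1`
  set k : ℤ := WithZero.log U with hk
  have hUk : U = WithZero.exp k := (WithZero.exp_log hU0).symm
  have hk1 : 1 ≤ k := by
    have : 0 < WithZero.log U := WithZero.lt_log_of_exp_lt (by rwa [WithZero.exp_zero])
    omega
  obtain ⟨m, hm⟩ : ∃ m : ℕ, (m : ℤ) + 1 = k := ⟨(k - 1).toNat, by omega⟩
  -- valuation of `u` and of the unit `w = u / 2^(m+1)`
  have hu : Valued.v ((C.u : v.adicCompletion ℚ)) = WithZero.exp (-k) := by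
    have h1 : Valued.v ((C.u : v.adicCompletion ℚ)) * U = 1 := by
      rw [hU, ← Valuation.map_mul, Units.mul_inv, Valuation.map_one]
    rw [hUk] at h1
    calc Valued.v ((C.u : v.adicCompletion ℚ)) = Valued.v ((C.u : v.adicCompletion ℚ)) * WithZero.exp k * WithZero.exp (-k) := by
          rw [mul_assoc, withZero_exp_mul_exp]; simp
      _ = WithZero.exp (-k) := by rw [h1, one_mul]
  have V2m : Valued.v ((2 : v.adicCompletion ℚ) ^ m) = WithZero.exp (-(m : ℤ)) := by
    rw [Valuation.map_pow, V2, ← WithZero.exp_nsmul]; simp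
  have V2m1 : Valued.v ((2 : v.adicCompletion ℚ) ^ (m + 1)) = WithZero.exp (-k) := by
    rw [Valuation.map_pow, V2, ← WithZero.exp_nsmul, ← hm]; simp
  set w : v.adicCompletion ℚ := (C.u : v.adicCompletion ℚ) / 2 ^ (m + 1) with hw
  have h2m1 : (2 : v.adicCompletion ℚ) ^ (m + 1) ≠ 0 := pow_ne_zero _ h20
  have hw1 : Valued.v w = 1 := by
    rw [hw, map_div₀, hu, V2m1, div_self WithZero.coe_ne_zero]
  have huw : (C.u : v.adicCompletion ℚ) = 2 ^ (m + 1) * w := by rw [hw]; field_simp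
  -- the rescaled descent `D • (C • Y)`, `D = ((2^m)⁻¹, 0, 0, 0)`
  have h2m : (2 : v.adicCompletion ℚ) ^ m ≠ 0 := pow_ne_zero _ h20
  set D : VariableChange (v.adicCompletion ℚ) := ⟨(Units.mk0 ((2 : v.adicCompletion ℚ) ^ m) h2m)⁻¹, 0, 0, 0⟩ with hD
  have hDu : (↑D.u⁻¹ : v.adicCompletion ℚ) = 2 ^ m := by simp [hD]
  set X : WeierstrassCurve (v.adicCompletion ℚ) := D • (C • Y) with hX
  -- integrality of `X`: `a_i(X) = 2^{m i} a_i(C • Y)`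
  obtain ⟨i1, i2, i3, i4, i6⟩ := (isIntegral_iff_forall_mem_range (C • Y)).mp hC
  have hle2m : Valued.v ((2 : v.adicCompletion ℚ) ^ m) ≤ 1 := by
    rw [V2m, ← WithZero.exp_zero, WithZero.exp_le_exp]; omega
  have hpowle : ∀ n : ℕ, Valued.v (((2 : v.adicCompletion ℚ) ^ m) ^ n) ≤ 1 := fun n ↦ by
    rw [Valuation.map_pow]; exact pow_le_one₀ zero_le hle2m
  have j1 : Valued.v X.a₁ ≤ 1 := by
    have e : X.a₁ = (2 : v.adicCompletion ℚ) ^ m * (C • Y).a₁ := by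
      rw [hX, variableChange_a₁, hDu]; simp [hD]
    rw [e, Valuation.map_mul]; exact mul_le_one' hle2m (hV1 _ i1)
  have j2 : Valued.v X.a₂ ≤ 1 := by
    have e : X.a₂ = ((2 : v.adicCompletion ℚ) ^ m) ^ 2 * (C • Y).a₂ := by
      rw [hX, variableChange_a₂, hDu]; simp [hD]
    rw [e, Valuation.map_mul]; exact mul_le_one' (hpowle 2) (hV1 _ i2)
  have j3 : Valued.v X.a₃ ≤ 1 := by
    have e : X.a₃ = ((2 : v.adicCompletion ℚ) ^ m) ^ 3 * (C • Y).a₃ := by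
      rw [hX, variableChange_a₃, hDu]; simp [hD]
    rw [e, Valuation.map_mul]; exact mul_le_one' (hpowle 3) (hV1 _ i3)
  have j4 : Valued.v X.a₄ ≤ 1 := by
    have e : X.a₄ = ((2 : v.adicCompletion ℚ) ^ m) ^ 4 * (C • Y).a₄ := by
      rw [hX, variableChange_a₄, hDu]; simp [hD]
    rw [e, Valuation.map_mul]; exact mul_le_one' (hpowle 4) (hV1 _ i4)
  have j6 : Valued.v X.a₆ ≤ 1 := by
    have e : X.a₆ = ((2 : v.adicCompletion ℚ) ^ m) ^ 6 * (C • Y).a₆ := by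
      rw [hX, variableChange_a₆, hDu]; simp [hD]
    rw [e, Valuation.map_mul]; exact mul_le_one' (hpowle 6) (hV1 _ i6)
  -- invariants of `X` in terms of `w`
  have hw0 : w ≠ 0 := by
    intro h; rw [h, Valuation.map_zero] at hw1; exact zero_ne_one hw1
  have h16 : (16 : v.adicCompletion ℚ) ≠ 0 := by
    rw [show (16 : v.adicCompletion ℚ) = 2 ^ 4 by norm_num]; exact pow_ne_zero _ h20
  have h64 : (64 : v.adicCompletion ℚ) ≠ 0 := by
    rw [show (64 : v.adicCompletion ℚ) = 2 ^ 6 by norm_num]; exact pow_ne_zero _ h20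
  have hX4 : X.c₄ = Y.c₄ / (16 * w ^ 4) := by
    rw [hX, variableChange_c₄, variableChange_c₄, hDu, Units.val_inv_eq_inv_val, huw]
    field_simp [h16]
    ring
  have hX6 : X.c₆ = Y.c₆ / (64 * w ^ 6) := by
    rw [hX, variableChange_c₆, variableChange_c₆, hDu, Units.val_inv_eq_inv_val, huw]
    field_simp [h64]
    ring
  have hKr := kraus_two_of_integral v hv X j1 j2 j3 j4 j6
  rw [hX4, hX6] at hKr
  exact hK w hw1 hKr

variable (W : WeierstrassCurve ℚ)

/-- **Integer Kraus test at `2`.** For `W/ℚ` integral at the place `v` of `2` with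
`c₄(W) = 16·x` and `c₆(W) = 64·y` (`x, y ∈ ℤ`) such that NEITHER `16 ∣ x ∧ (32 ∣ y ∨ 32 ∣ y − 8)`
NOR `4 ∣ y + 1`: `W` is minimal at `v`. For a `2`-adic unit `w`, `c₄/(16w⁴) = x·w⁻⁴` has `|·| = |x|`
and `c₆/(64w⁶) = y·w⁻⁶ = y + y(w⁻⁶ − 1)` with `|w⁻⁶ − 1| ≤ 2⁻³`, so the three Kraus tests on the
descended pair read exactly `16 ∣ x`, `32 ∣ y ∨ 32 ∣ y − 8`, `4 ∣ y + 1` — all excluded; conclude by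
`isMinimal_two_of_kraus_fails_general`. [cite: Kraus1989, Prop. 2]
[cite: CremonaAlgorithms1997, §3.2 (Laska–Kraus–Connell)] -/
theorem isMinimalAt_two_of_kraus_violated (hv : natGenerator v = 2) (hint : W.IsIntegralAt v)
    {x y : ℤ} (hx : W.c₄ = 16 * x) (hy : W.c₆ = 64 * y)
    (h : ¬ (((16 : ℤ) ∣ x ∧ ((32 : ℤ) ∣ y ∨ (32 : ℤ) ∣ y - 8)) ∨ (4 : ℤ) ∣ y + 1)) :
    W.IsMinimalAt v := by
  set K := v.adicCompletion ℚ with hK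
  set Y : WeierstrassCurve K := W.baseChange K with hY
  haveI : Y.IsIntegral (v.adicCompletionIntegers ℚ) := hint
  have V2 := valued_two v hv
  have h20 : (2 : K) ≠ 0 := by
    intro h; rw [h, Valuation.map_zero] at V2; exact WithZero.coe_ne_zero V2.symm
  have V8 : Valued.v (8 : K) = WithZero.exp (-3 : ℤ) := by
    rw [show (8 : K) = 2 ^ 3 by norm_num, Valuation.map_pow, V2, ← WithZero.exp_nsmul]; norm_num
  have hYc4 : Y.c₄ = 16 * algebraMap ℚ K x := by
    rw [hY, WeierstrassCurve.baseChange, map_c₄, hx, map_mul]; norm_num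
  have hYc6 : Y.c₆ = 64 * algebraMap ℚ K y := by
    rw [hY, WeierstrassCurve.baseChange, map_c₆, hy, map_mul]; norm_num
  set xK : K := algebraMap ℚ K x with hxK
  set yK : K := algebraMap ℚ K y with hyK
  -- integer valuations at `v`
  have hdv : ∀ (n : ℤ) (e : ℕ), (2 : ℤ) ^ e ∣ n →
      Valued.v (algebraMap ℚ K n) ≤ WithZero.exp (-(e : ℤ)) := fun n e hne ↦
    valued_intCast_le_of_dvd v hv hne
  have hnd : ∀ (n : ℤ) (e : ℕ), ¬ (2 : ℤ) ^ e ∣ n →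
      WithZero.exp (-(e : ℤ)) < Valued.v (algebraMap ℚ K n) := fun n e hne ↦ by
    rw [WeierstrassCurve.valued_algebraMap_adicCompletion]
    exact exp_neg_lt_valuation_intCast_of_not_pow_dvd v (by rw [hv]; exact_mod_cast hne)
  have hyle : Valued.v yK ≤ 1 := by
    have h0 := hdv y 0 (by simp)
    rwa [Nat.cast_zero, neg_zero, WithZero.exp_zero] at h0
  refine isMinimal_two_of_kraus_fails_general v hv Y fun w hw H ↦ ?_
  have hw0 : w ≠ 0 := by
    intro h0; rw [h0, Valuation.map_zero] at hw; exact zero_ne_one hw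
  have hwi : Valued.v w⁻¹ = 1 := by rw [map_inv₀, hw, inv_one]
  have h16 : (16 : K) ≠ 0 := by rw [show (16 : K) = 2 ^ 4 by norm_num]; exact pow_ne_zero _ h20
  have h64 : (64 : K) ≠ 0 := by rw [show (64 : K) = 2 ^ 6 by norm_num]; exact pow_ne_zero _ h20
  have e4 : Y.c₄ / (16 * w ^ 4) = xK * w⁻¹ ^ 4 := by
    rw [hYc4, mul_div_mul_left _ _ h16, div_eq_mul_inv, inv_pow]
  have e6 : Y.c₆ / (64 * w ^ 6) = yK + yK * (w⁻¹ ^ 6 - 1) := by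
    rw [hYc6, mul_div_mul_left _ _ h64, div_eq_mul_inv, ← inv_pow]; ring
  have hsmall : Valued.v (yK * (w⁻¹ ^ 6 - 1)) ≤ WithZero.exp (-3 : ℤ) := by
    rw [Valuation.map_mul]
    calc Valued.v yK * Valued.v (w⁻¹ ^ 6 - 1) ≤ 1 * WithZero.exp (-3 : ℤ) :=
          mul_le_mul' hyle (valued_pow_six_sub_one_le v hv hwi)
      _ = WithZero.exp (-3 : ℤ) := one_mul _
  rw [e4, e6] at H
  rcases H with ⟨h4, h56⟩ | h3
  · -- `|x| ≤ 2⁻⁴`, i.e. `16 ∣ x`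
    have hx16 : (16 : ℤ) ∣ x := by
      by_contra hx16
      have := hnd x 4 (by norm_num; exact hx16)
      rw [Valuation.map_mul, Valuation.map_pow, hwi, one_pow, mul_one] at h4
      exact absurd (lt_of_lt_of_le this h4) (lt_irrefl _)
    have hy : ¬ ((32 : ℤ) ∣ y ∨ (32 : ℤ) ∣ y - 8) := fun hy ↦ h (Or.inl ⟨hx16, hy⟩)
    push Not at hy
    obtain ⟨hy32, hy8⟩ := hy
    have hygt : WithZero.exp (-5 : ℤ) < Valued.v yK := hnd y 5 (by norm_num; exact hy32)
    have hy8gt : WithZero.exp (-5 : ℤ) < Valued.v (yK - 8) := by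
      have := hnd (y - 8) 5 (by norm_num; exact hy8)
      rwa [Int.cast_sub, map_sub, show ((8 : ℤ) : ℚ) = 8 by norm_num, map_ofNat] at this
    rcases h56 with h5 | h5
    · -- `|y + y(w⁻⁶-1)| = |y|` unless `|y| ≤ 2⁻³`, and then still `> 2⁻⁵` fails? — split on `|y|` vs `2⁻³`
      by_cases hy3 : Valued.v yK ≤ WithZero.exp (-3 : ℤ)
      · -- then `8 ∣ y`, `|y(w⁻⁶-1)| ≤ 2⁻³|y| < |y|`
        have hlt : Valued.v (yK * (w⁻¹ ^ 6 - 1)) < Valued.v yK := by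
          rw [Valuation.map_mul]
          calc Valued.v yK * Valued.v (w⁻¹ ^ 6 - 1) ≤ Valued.v yK * WithZero.exp (-3 : ℤ) :=
                mul_le_mul' le_rfl (valued_pow_six_sub_one_le v hv hwi)
            _ < Valued.v yK * 1 := by
                refine mul_lt_mul_of_pos_left ?_ (lt_of_lt_of_le WithZero.exp_pos hygt.le |>.trans_le' le_rfl)
                rw [← WithZero.exp_zero, WithZero.exp_lt_exp]; norm_num
            _ = Valued.v yK := mul_one _
        rw [Valuation.map_add_eq_of_lt_left _ hlt] at h5
        exact absurd (lt_of_lt_of_le hygt h5) (lt_irrefl _)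
      · -- `|y| > 2⁻³ ≥ |y(w⁻⁶-1)|`
        replace hy3 : WithZero.exp (-3 : ℤ) < Valued.v yK := not_le.mp hy3
        have hlt : Valued.v (yK * (w⁻¹ ^ 6 - 1)) < Valued.v yK := lt_of_le_of_lt hsmall hy3
        rw [Valuation.map_add_eq_of_lt_left _ hlt] at h5
        exact absurd (lt_of_lt_of_le hygt h5) (lt_irrefl _)
    · -- `|y + y(w⁻⁶-1) - 8| ≤ 2⁻⁵`
      by_cases hy3 : Valued.v yK ≤ WithZero.exp (-3 : ℤ)
      · -- `|y(w⁻⁶ - 1)| ≤ 2⁻⁶ < 2⁻⁵ < |y - 8|`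
        have hsmall' : Valued.v (yK * (w⁻¹ ^ 6 - 1)) ≤ WithZero.exp (-6 : ℤ) := by
          rw [Valuation.map_mul]
          calc Valued.v yK * Valued.v (w⁻¹ ^ 6 - 1) ≤ WithZero.exp (-3 : ℤ) * WithZero.exp (-3 : ℤ) :=
                mul_le_mul' hy3 (valued_pow_six_sub_one_le v hv hwi)
            _ = WithZero.exp (-6 : ℤ) := by rw [withZero_exp_mul_exp]; norm_num
        have hlt : Valued.v (yK * (w⁻¹ ^ 6 - 1)) < Valued.v (yK - 8) :=
          lt_of_le_of_lt hsmall' (lt_trans (by rw [WithZero.exp_lt_exp]; norm_num) hy8gt)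
        have : yK + yK * (w⁻¹ ^ 6 - 1) - 8 = (yK - 8) + yK * (w⁻¹ ^ 6 - 1) := by ring
        rw [this, Valuation.map_add_eq_of_lt_left _ hlt] at h5
        exact absurd (lt_of_lt_of_le hy8gt h5) (lt_irrefl _)
      · -- `|y| > 2⁻³ = |8|`: `|y + y(w⁻⁶-1) - 8| = |y| > 2⁻⁵`
        replace hy3 : WithZero.exp (-3 : ℤ) < Valued.v yK := not_le.mp hy3
        have hlt1 : Valued.v (yK * (w⁻¹ ^ 6 - 1)) < Valued.v yK := lt_of_le_of_lt hsmall hy3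
        have hlt2 : Valued.v (8 : K) < Valued.v yK := by rw [V8]; exact hy3
        have hlt : Valued.v (yK * (w⁻¹ ^ 6 - 1) - 8) < Valued.v yK := Valuation.map_sub_lt _ hlt1 hlt2
        have : yK + yK * (w⁻¹ ^ 6 - 1) - 8 = yK + (yK * (w⁻¹ ^ 6 - 1) - 8) := by ring
        rw [this, Valuation.map_add_eq_of_lt_left _ hlt] at h5
        exact absurd (lt_of_lt_of_le (lt_trans (by rw [WithZero.exp_lt_exp]; norm_num) hy3) h5) (lt_irrefl _)
  · -- `|y + y(w⁻⁶-1) + 1| ≤ 2⁻²`, but `4 ∤ y + 1`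
    have hy1 : ¬ (4 : ℤ) ∣ y + 1 := fun hy1 ↦ h (Or.inr hy1)
    have hy1gt : WithZero.exp (-2 : ℤ) < Valued.v (yK + 1) := by
      have := hnd (y + 1) 2 (by norm_num; exact hy1)
      rwa [Int.cast_add, map_add, show ((1 : ℤ) : ℚ) = 1 by norm_num, map_one] at this
    have hlt : Valued.v (yK * (w⁻¹ ^ 6 - 1)) < Valued.v (yK + 1) :=
      lt_of_le_of_lt hsmall (lt_trans (by rw [WithZero.exp_lt_exp]; norm_num) hy1gt)
    have : yK + yK * (w⁻¹ ^ 6 - 1) + 1 = (yK + 1) + yK * (w⁻¹ ^ 6 - 1) := by ring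
    rw [this, Valuation.map_add_eq_of_lt_left _ hlt] at h3
    exact absurd (lt_of_lt_of_le hy1gt h3) (lt_irrefl _)

/-- A prime dividing a product of powers of primes is one of them (triple-list form of
`mem_of_prime_dvd_prod_pow`, `VisibilityPrimeList.lean`). [folklore] -/
private theorem mem_of_prime_dvd_prod_triple {q : ℕ} (hq : q.Prime) :
    ∀ (l : List (ℕ × ℕ × ℕ)), (∀ t ∈ l, t.1.Prime) → q ∣ (l.map fun t => t.1 ^ t.2.2).prod →
      ∃ t ∈ l, t.1 = q
  | [], _, h => by
    simp only [List.map_nil, List.prod_nil, Nat.dvd_one] at h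
    exact absurd h hq.one_lt.ne'
  | t :: l, hl, h => by
    rw [List.map_cons, List.prod_cons] at h
    rcases (Nat.Prime.dvd_mul hq).mp h with h1 | h1
    · exact ⟨t, List.mem_cons_self, ((Nat.prime_dvd_prime_iff_eq hq (hl t List.mem_cons_self)).mp
        (hq.dvd_of_dvd_pow h1)).symm⟩
    · obtain ⟨t', ht', h'⟩ := mem_of_prime_dvd_prod_triple hq l (fun t' ht' ↦ hl t' (List.mem_cons_of_mem _ ht')) h1
      exact ⟨t', List.mem_cons_of_mem _ ht', h'⟩

/-- **Global minimality of an integer model from the support of `Δ` and a per-prime test — no size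
bound** (the shape `decide` evaluates on a certificate record: `bad = [(q, v_q N, v_q Δ), …]` with
`|Δ(ainvs)| = ∏ q^{v_q Δ}` and every `q` prime). At each listed `q`: Silverman's disjuncts
`q¹² ∤ Δ ∨ q⁴ ∤ c₄` (AEC VII.1 Rem. 1.1), or `q = 2`, `16 ∣ c₄`, `64 ∣ c₆` and the integer Kraus test
of `isMinimalAt_two_of_kraus_violated`, or `q = 3` and `3⁸ ‖ c₆` (`isMinimal_three_of_valued_c₆`);
a prime off the list does not divide `Δ`, so Silverman's criterion holds there trivially.
[cite: SilvermanAEC2009, VII.1 Remark 1.1 and VIII.8] [cite: Kraus1989, Prop. 1 and Prop. 2] -/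
theorem isGloballyMinimal_of_krausCriterion_support (a1 a2 a3 a4 a6 : ℤ) (bad : List (ℕ × ℕ × ℕ))
    (hprime : ∀ t ∈ bad, t.1.Prime)
    (hsupp : (discOf [a1, a2, a3, a4, a6]).natAbs = (bad.map fun t => t.1 ^ t.2.2).prod)
    (h : ∀ t ∈ bad,
      (¬ (t.1 : ℤ) ^ 12 ∣ discOf [a1, a2, a3, a4, a6] ∨ ¬ (t.1 : ℤ) ^ 4 ∣ c4Of [a1, a2, a3, a4, a6]) ∨
      (t.1 = 2 ∧ (16 : ℤ) ∣ c4Of [a1, a2, a3, a4, a6] ∧ (64 : ℤ) ∣ c6Of [a1, a2, a3, a4, a6] ∧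
        ¬ (((16 : ℤ) ∣ c4Of [a1, a2, a3, a4, a6] / 16 ∧
            ((32 : ℤ) ∣ c6Of [a1, a2, a3, a4, a6] / 64 ∨ (32 : ℤ) ∣ c6Of [a1, a2, a3, a4, a6] / 64 - 8)) ∨
          (4 : ℤ) ∣ c6Of [a1, a2, a3, a4, a6] / 64 + 1)) ∨
      (t.1 = 3 ∧ (3 : ℤ) ^ 8 ∣ c6Of [a1, a2, a3, a4, a6] ∧ ¬ (3 : ℤ) ^ 9 ∣ c6Of [a1, a2, a3, a4, a6])) :
    (⟨a1, a2, a3, a4, a6⟩ : WeierstrassCurve ℚ).IsGloballyMinimal where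
  isIntegral := isIntegral_of_exists_lift (𝓞 ℚ) ⟨(a1 : 𝓞 ℚ), by simp⟩ ⟨(a2 : 𝓞 ℚ), by simp⟩
    ⟨(a3 : 𝓞 ℚ), by simp⟩ ⟨(a4 : 𝓞 ℚ), by simp⟩ ⟨(a6 : 𝓞 ℚ), by simp⟩
  isMinimal v := by
    set W : WeierstrassCurve ℚ := ⟨a1, a2, a3, a4, a6⟩ with hW
    have hle : ∀ m : ℤ, v.valuation ℚ (m : ℚ) ≤ 1 := fun m ↦ by
      have hm : (m : ℚ) = algebraMap (𝓞 ℚ) ℚ (m : 𝓞 ℚ) := by simp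
      rw [hm]
      exact v.valuation_le_one _
    have hint : W.IsIntegralAt v :=
      W.isIntegralAt_of_valuation_le_one v (hle a1) (hle a2) (hle a3) (hle a4) (hle a6)
    have hΔ : W.Δ = ((discOf [a1, a2, a3, a4, a6] : ℤ) : ℚ) := by
      simp only [hW, WeierstrassCurve.Δ, WeierstrassCurve.b₂, WeierstrassCurve.b₄, WeierstrassCurve.b₆,
        WeierstrassCurve.b₈, discOf, invariants]
      push_cast
      ring
    have hc4 : W.c₄ = ((c4Of [a1, a2, a3, a4, a6] : ℤ) : ℚ) := by
      simp only [hW, WeierstrassCurve.c₄, WeierstrassCurve.b₂, WeierstrassCurve.b₄, c4Of, invariants]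
      push_cast
      ring
    have hc6 : W.c₆ = ((c6Of [a1, a2, a3, a4, a6] : ℤ) : ℚ) := by
      simp only [hW, WeierstrassCurve.c₆, WeierstrassCurve.b₂, WeierstrassCurve.b₄, WeierstrassCurve.b₆,
        c6Of, invariants]
      push_cast
      ring
    set q := natGenerator v with hq
    have hqp : q.Prime := prime_natGenerator v
    by_cases hmem : ∃ t ∈ bad, t.1 = q
    · obtain ⟨t, ht, htq⟩ := hmem
      rcases h t ht with (h12 | h4) | ⟨h2, h16, h64, hk⟩ | ⟨h3, h8, h9⟩
      · exact isMinimalAt_of_lt_valuation_Δ_holds hint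
          (by rw [hΔ]; exact exp_neg_lt_valuation_intCast_of_not_pow_dvd v (by rw [← hq, ← htq]; exact h12))
      · exact isMinimalAt_of_lt_valuation_c₄ hint
          (by rw [hc4]; exact exp_neg_lt_valuation_intCast_of_not_pow_dvd v (by rw [← hq, ← htq]; exact h4))
      · have hv2 : natGenerator v = 2 := by rw [← hq, ← htq, h2]
        refine isMinimalAt_two_of_kraus_violated v W hv2 hint (x := c4Of [a1, a2, a3, a4, a6] / 16)
          (y := c6Of [a1, a2, a3, a4, a6] / 64) ?_ ?_ hk
        · rw [hc4]; exact_mod_cast (Int.mul_ediv_cancel' h16).symm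
        · rw [hc6]; exact_mod_cast (Int.mul_ediv_cancel' h64).symm
      · have hv3 : natGenerator v = 3 := by rw [← hq, ← htq, h3]
        haveI : (W.baseChange (v.adicCompletion ℚ)).IsIntegral (v.adicCompletionIntegers ℚ) := hint
        have hYc6 : Valued.v (W.baseChange (v.adicCompletion ℚ)).c₆ = v.valuation ℚ W.c₆ := by
          rw [WeierstrassCurve.baseChange, map_c₆, WeierstrassCurve.valued_algebraMap_adicCompletion]
        refine isMinimal_three_of_valued_c₆ v hv3 _ ?_ ?_
        · rw [hYc6, hc6]
          exact_mod_cast Rat.valuation_intCast_le v (e := 8) (by rw [hv3]; exact_mod_cast h8)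
        · rw [hYc6, hc6]
          exact_mod_cast exp_neg_lt_valuation_intCast_of_not_pow_dvd v (e := 9)
            (by rw [hv3]; exact_mod_cast h9)
    · -- `q ∉ bad`: `q ∤ Δ`, hence `q¹² ∤ Δ`
      have hnd : ¬ (q : ℤ) ^ 12 ∣ discOf [a1, a2, a3, a4, a6] := fun hd ↦ hmem (by
        have hqd : q ∣ (discOf [a1, a2, a3, a4, a6]).natAbs := by
          rw [← Int.natCast_dvd]
          exact dvd_trans (dvd_pow_self (q : ℤ) (by norm_num)) hd
        rw [hsupp] at hqd
        exact mem_of_prime_dvd_prod_triple hqp bad hprime hqd)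
      exact isMinimalAt_of_lt_valuation_Δ_holds hint
        (by rw [hΔ]; exact exp_neg_lt_valuation_intCast_of_not_pow_dvd v (by rw [← hq]; exact hnd))

end Two

end Summit.BirchSwinnertonDyer.Rank1Residual.X11b

end
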